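import Summits.Parity.GeneralizedHardyLittlewood.Theses.LeeYangFibres
import Summits.Parity.GeneralizedHardyLittlewood.Theorems.LeeYangFibresHyperbolicityClipsParity
import Summits.Parity.GeneralizedHardyLittlewood.Theorems.LeeYangFibresModelCellFacts
import Summits.Parity.GeneralizedHardyLittlewood.Theorems.LeeYangFibresCellsToRelativeDimOne
import Summits.Parity.GeneralizedHardyLittlewood.Theorems.LeeYangFibresRelativeDimOneHardness
import Summits.Parity.GeneralizedHardyLittlewood.Theorems.LeeYangFibresAbsoluteUpgradeSiegelGuard
import HarnessLib

/-!
# Crux `PrimeCellsRelative` (stmt-Parity-14112), line `Sketch`: in-route closure path and `L`-function hardness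

Sorry-free compositions recording, on this crux item, the two locator edges that the cycle-1 Locator file
(`LeeYangFibresPrimeCellsRelativeLocator`: `PCR ↔ RelativeDimOne`, `DimOne → PCR`, `GHL → PCR`, the `t = 1`
slice, `PCR → TwinPrimeConjecture`) does not yet carry:

* **in-route closure path.** `primeCellsRelative_of_cellParityLaw_of_fibreHyperbolicity :
  CellParityLaw → FibreHyperbolicity → PrimeCellsRelative` — the route's two ranked mechanism cruxes
  (stmt-Parity-14109, stmt-Parity-14108) imply the crux, by the CLOSED supports `HyperbolicityClipsParity`
  (stmt-Parity-14114, `Theorems.HyperbolicityClipsParity_proof`) and `ModelCellFacts` (stmt-Parity-14111,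
  `Theorems.modelCellFacts_proof`); composed once more with the CLOSED `CellsToRelativeDimOne` (stmt-Parity-14115)
  they reach the hypothesis `RelativeDimOne` of the route's deciding theorem `closes`
  (`relativeDimOne_of_cellParityLaw_of_fibreHyperbolicity`). So the crux closes by pure logic the moment
  14108 and 14109 do, exactly as it closes the moment 14113 (`primeCellsRelative_of_relativeDimOne`) or 0819
  (`primeCellsRelative_of_dimOne`) does.
* **`L`-function hardness.** Through `cellsToRelativeDimOne_proof : PrimeCellsRelative → RelativeDimOne` the
  crux inherits the necessity certificates of the `RelativeDimOne` line `translate-amplification`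
  (`Theorems/LeeYangFibresRelativeDimOneHardness`): `primeCellsRelative_implies_upperRelativeDimOne` and
  **`primeCellsRelative_implies_uniformCharPNT : PrimeCellsRelative → UniformCharPNT`** — any proof of the crux
  proves the prime number theorem `ψ(N, χ) = o(N)` for EVERY non-principal Dirichlet character of conductor
  `q ≤ N^θ`, every `θ < 1` (Gallagher's identity backwards + orthogonality; a consequence of GRH, open
  unconditionally); and the Siegel guard of the `AbsoluteUpgrade` line
  (`Theorems/LeeYangFibresAbsoluteUpgradeSiegelGuard`): **`primeCellsRelative_not_unboundedSiegelZeros :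
  MatomakiMerikoski2023_pairCorrelation → PrimeCellsRelative → ¬ UnboundedSiegelZeros`** — modulo the vendored
  theorem of Matomäki–Merikoski (Thm 1.3), the crux excludes Siegel zeros of unbounded quality. This sharpens
  the landed certificate `PCR → TwinPrimeConjecture` from "twin-prime-hard" to "GRH-lite-hard" and makes the
  catalogued barrier `Literature.Barriers.Parity.SiegelZeroPrimePairs` formal for this crux: every line must
  contain, or imply, a Siegel-repelling input.

References: B. Green, T. Tao, *Linear equations in primes*, Ann. of Math. 171 (2010), Conj. 1.4 [GreenTao2010];
P. X. Gallagher, Mathematika 23 (1976) [Gallagher1976]; K. Matomäki, J. Merikoski, *Siegel zeros, twin primes,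
Goldbach's conjecture, and primes in short intervals*, IMRN (2023), Thm 1.3 [MatomakiMerikoski2023].
-/

noncomputable section

namespace Summit.Parity.GeneralizedHardyLittlewood.Cruxes.PrimeCellsRelative.Sketch

open Summit.Parity.GeneralizedHardyLittlewood.Theses.LeeYangFibres
open Summit.Parity.GeneralizedHardyLittlewood.Theorems (HyperbolicityClipsParity_proof modelCellFacts_proof)
open Summit.Parity.GeneralizedHardyLittlewood.Theorems.LeeYangFibresCells (cellsToRelativeDimOne_proof)
open Summit.Parity.GeneralizedHardyLittlewood.Cruxes.RelativeDimOne.GallagherBackwards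
  (UniformCharPNT UpperRelativeDimOne uniformCharPNT_of_relativeDimOne upperRelativeDimOne_of_relativeDimOne)
open Literature.Barriers.Parity (MatomakiMerikoski2023_pairCorrelation UnboundedSiegelZeros)

/-! ## The in-route closure path -/

/-- **The route's two ranked cruxes imply the crux.** `CellParityLaw` (stmt-Parity-14109) and
`FibreHyperbolicity` (stmt-Parity-14108) give `PrimeCellsRelative`, by the clipping lemma
`HyperbolicityClipsParity` (stmt-Parity-14114, CLOSED: `Theorems.HyperbolicityClipsParity_proof`) fed with the
rough-integer anatomy `ModelCellFacts` (stmt-Parity-14111, CLOSED: `Theorems.modelCellFacts_proof`). Pure logic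
over two closed items: the crux closes the moment 14108 and 14109 do. -/
theorem primeCellsRelative_of_cellParityLaw_of_fibreHyperbolicity :
    CellParityLaw → FibreHyperbolicity → PrimeCellsRelative :=
  fun hL hH => HyperbolicityClipsParity_proof hL hH modelCellFacts_proof

/-- **The same path reaches the hypothesis of `closes`.** `CellParityLaw → FibreHyperbolicity → RelativeDimOne`
through the crux and the CLOSED partial-summation support `CellsToRelativeDimOne` (stmt-Parity-14115,
`Theorems.LeeYangFibresCells.cellsToRelativeDimOne_proof`): the route's deciding theorem
`closes (hR : RelativeDimOne) (hU : AbsoluteUpgrade) (hF : FibrationLemma)` can take the ranked cruxes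
14109, 14108 in place of the derived node `hR`. -/
theorem relativeDimOne_of_cellParityLaw_of_fibreHyperbolicity :
    CellParityLaw → FibreHyperbolicity → RelativeDimOne :=
  fun hL hH => cellsToRelativeDimOne_proof (primeCellsRelative_of_cellParityLaw_of_fibreHyperbolicity hL hH)

/-! ## `L`-function hardness of the crux -/

/-- The crux already contains the UPPER HALF of relative Dickson–Hardy–Littlewood at `d = 1`:
`S(Ψ, K, N) ≤ (1 + ε) β_∞ 𝔖 + ε N` uniformly over non-degenerate systems of size `≤ L` and convex
`K ⊆ [-N, N]` (through `cellsToRelativeDimOne_proof` and `upperRelativeDimOne_of_relativeDimOne`). -/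
theorem primeCellsRelative_implies_upperRelativeDimOne : PrimeCellsRelative → UpperRelativeDimOne :=
  fun h => upperRelativeDimOne_of_relativeDimOne (cellsToRelativeDimOne_proof h)

/-- **The crux is `UniformCharPNT`-hard.** Any proof of `PrimeCellsRelative` proves the prime number theorem
`‖ψ(N, χ)‖ ≤ ε N` for every non-principal Dirichlet character `χ mod q` with `2 ≤ q ≤ N^θ`, every `θ < 1`,
`N ≥ N₀(θ, ε)` — a consequence of GRH that is open unconditionally (Siegel zeros; zeros at `1 - C/log q`; no
`L`-function tool at all for `q > N^{1/2}`). Composition of `cellsToRelativeDimOne_proof` (stmt-Parity-14115)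
with the necessity certificate `uniformCharPNT_of_relativeDimOne` of the `RelativeDimOne` line (upper-half
amplification over translate-constellations, Gallagher's identity backwards, orthogonality of characters).
[cite: Gallagher1976] [cite: GreenTao2010, Conj. 1.4] -/
theorem primeCellsRelative_implies_uniformCharPNT : PrimeCellsRelative → UniformCharPNT :=
  fun h => uniformCharPNT_of_relativeDimOne (cellsToRelativeDimOne_proof h)

/-- **The Siegel guard for the crux.** Modulo the vendored theorem of Matomäki–Merikoski
(`MatomakiMerikoski2023_pairCorrelation`, Theorem 1.3: an exceptional zero doubles the Hardy–Littlewood main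
term of `∑_{n ≤ X} Λ(n) Λ(n + 2q)`), the crux excludes Siegel zeros of unbounded quality: it contains, through
`cellsToRelativeDimOne_proof`, the shift-uniform pair asymptotic at `(n, n + 2q)`, `N = q^{10}`, that
`Theorems.AbsoluteUpgrade.stub_siegelGuard` plays against the doubled main term. This is the catalogued barrier
`Literature.Barriers.Parity.SiegelZeroPrimePairs` made formal for this crux. [cite: MatomakiMerikoski2023, Theorem 1.3] -/
theorem primeCellsRelative_not_unboundedSiegelZeros :
    MatomakiMerikoski2023_pairCorrelation → PrimeCellsRelative → ¬ UnboundedSiegelZeros :=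
  fun hMM h => Theorems.AbsoluteUpgrade.stub_siegelGuard hMM (cellsToRelativeDimOne_proof h)

end Summit.Parity.GeneralizedHardyLittlewood.Cruxes.PrimeCellsRelative.Sketch

end
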